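import Summits.NavierStokesRegularity.FunctionalMining.TopEigLaminateTwo
import Summits.NavierStokesRegularity.FunctionalMining.TopEigHeatRate
import Summits.NavierStokesRegularity.FunctionalMining.SpectralMixtureCandidates
import HarnessLib
/-!
# FunctionalMining / NoGo — K32: the endpoint `q = 1` of Lemma L-λ decided in the kernel — `C_λ(1) = 0`:
# `¬ TopEigHeatCoercivePos 1`, `¬ NegBotEigHeatCoercivePos 1`, `¬ TopBotEigHeatCoercivePos 1`

HONEST FRAMING. Search for candidate a priori estimates; no regularity claim. Nothing about
Navier–Stokes is proved or asserted in this file: it evaluates the dictionary's STATIC heat-line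
functionals (`TopEigHeatCoercive.lean`: `heatDissipation Φ v = sup_{t>0} (Φ(v) − Φ(v + tΔv))/t`; no
transport, no pressure) on ONE explicit smooth divergence-free zero-mean field of `T³` and books the
outcome against the constant `C_λ(q) = TopEig.topEigHeatRate q` (`TopEigHeatRate.lean`, kernel window
`C_λ(q) ∈ [0, 4π²q]` for every real `q ≥ 1`). Cell `pub-nsfunc`, no-go seat (gen 45). [ours, calibration]

THE WITNESS: the laminate `u_F = (F(x₂), 0, 0)` (`TopEigLaminate.lamU`) with the profile
`F(s) = −cos(2πs)/(2π) + cos³(2πs)/(6π)` (`sinCubePrim`), `F′ = sin³(2π·)`, `F″ = 6π sin²(2π·)cos(2π·)`.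
* `topEigMoment_one_line` — for EVERY profile: `∫(λ₁⁺)¹(u_F + tΔu_F) = ∫((−λ₃)⁺)¹(…) = ∫₀¹|F′/2 + tF‴/2|`
  (plane shear, eigenvalues `±½|F′ + tF‴|, 0`: `lam_sq_line` + Lemma D);
  `heatDissipation_nonpos_of_line_le` — if `Φ(v) ≤ Φ(v + tΔv)` for all `t > 0` then `D(Φ)(v) ≤ 0`;
* `integral_abs_line_ge` — **`∫₀¹|F′ + tF‴| ≥ 4/(3π) = ∫₀¹|F′|` for EVERY real `t`**: split `[0,1]` at `½`;
  on each half `∫|F′ + tF‴| ≥ |∫(F′ + tF‴)| = |[F + tF″]| = 2/(3π)` because `F″` VANISHES at `0, ½, 1`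
  (the zeros of `F′ = sin³` are triple). So `∫(λ₁⁺)(u_F + tΔu_F) ≥ ∫(λ₁⁺)(u_F) = 2/(3π) > 0` for all `t`,
  the dissipation of `u_F` is `≤ 0` (indeed `= 0`, `heatDissipation_topEigMoment_one_sinCubePrim`), while
  `u_F` is smooth, divergence free and zero-mean (`∫₀¹F = 0`, `hasZeroMean_lamU_sinCubePrim`);
* **`topEigHeatRate_one : C_λ(1) = 0`**, **`not_topEigHeatCoercivePos_one`**, `not_negBotEigHeatCoercivePos_one`,
  `negBotEigHeatRate_one`, `topEigHeatCoercive_one_iff : TopEigHeatCoercive 1 c ↔ c ≤ 0`, and for door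
  D-K6 (c)'s symmetrised core `Φ₁ + Ψ₁`: **`not_topBotEigHeatCoercivePos_one : ¬ TopBotEigHeatCoercivePos 1`**.

SCOPE, EXACTLY: `q = 1` only. For `q > 1` laminates are NOT witnesses (`D(∫(λ₁⁺)^q)(u_F) =
2^{−q}q(q−1)∫₀¹|F′|^{q−2}F″² > 0`, pen; `q = 2`: `TopEigLaminateRigid`), and the node stays OPEN in the
kernel for every real `q > 1` (pen-FALSE for `q ≥ 2` by the seat's (F1), NOGO.md §1/§7, not in the kernel).
The mechanism is first-order FLATNESS of `λ₁ = ½|F′ + tF‴|` at the zero set of the strain; nothing about `q < 1`.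
PROVENANCE / STATUS. Typed by the no-go seat (gen 45); farm-checked STAND-ALONE under its three TREE imports
(`lean check` rc 0, 0 sorries, 0 warnings; `--axioms not_topBotEigHeatCoercivePos_one` = propext, Classical.choice,
Quot.sound); pen note `pub-nsfunc-nogo/sieveld/lamq1/LAMINATE-Q1-NOTE.md`. STATUS: STAGED (filing: prove seat, LEAD slot).
FILING (prove seat g27, REQUEST #48): declarations byte-identical to the no-go seat's staged `TopEigHeatCoerciveOne.STAGING.lean` 782fbaf5533b7d69; this line is the only addition; ONE blank line removed after the imports for the 400-line cap (RULING (ω) normal form).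
-/


noncomputable section

open MeasureTheory Set intervalIntegral
open scoped ContDiff

namespace Summit.NavierStokesRegularity.FunctionalMining

open Literature.Analysis Literature.Analysis.FunctionSpaces Literature.Analysis.FunctionSpaces.Torus
open TopEig PlanarTopEig StrainL4 LaminateDirection

namespace TopEigLaminate

variable (F : ShearProfile)

/-! ## 1. The `q = 1` moments along the heat line of a general laminate -/

/-- Lemma D, absolute-value form: `∫_{T³} |P(x₂)/2 + t·Q(x₂)/2| dx = ∫₀¹ |P/2 + t·Q/2|`. [ours] -/
theorem integral_line_abs (P Q : ShearProfile) (t : ℝ) :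
    ∫ x, |dirFun e2 P x / 2 + t * (dirFun e2 Q x / 2)| =
      ∫ s in (0 : ℝ)..1, |P s / 2 + t * (Q s / 2)| := by
  have hc : Continuous fun y : UnitAddCircle => |P.onCircle y / 2 + t * (Q.onCircle y / 2)| :=
    ((P.continuous_onCircle.div_const _).add (continuous_const.mul (Q.continuous_onCircle.div_const _))).abs
  have h := integral_comp_dirForm e2_ne_zero (F := fun y => |P.onCircle y / 2 + t * (Q.onCircle y / 2)|)
    hc.aestronglyMeasurable
  simp only [dirFun] at h ⊢
  rw [h, CellularStretching.integral_circle_eq_intervalIntegral]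
  simp only [ShearProfile.onCircle_coe]

/-- `λ ≥ 0` and `λ² = a²` give `λ = |a|`. [folklore] -/
theorem eq_abs_of_sq_eq {l a : ℝ} (h : l ^ 2 = a ^ 2) (hl : 0 ≤ l) : l = |a| := by
  rw [← Real.sqrt_sq hl, h, Real.sqrt_sq_eq_abs]

/-- **The two `q = 1` moments along the heat line of `u_F`**:
`∫(λ₁⁺)¹(u_F + tΔu_F) = ∫((−λ₃)⁺)¹(u_F + tΔu_F) = ∫₀¹ |F′/2 + t·F‴/2|`. [ours] -/
theorem topEigMoment_one_line (t : ℝ) :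
    torusTopEigMoment 1 (lamU F + t • Torus.laplacian (lamU F)) =
        ∫ s in (0 : ℝ)..1, |F.D s / 2 + t * (F.D.D.D s / 2)| ∧
      torusNegBotEigMoment 1 (lamU F + t • Torus.laplacian (lamU F)) =
        ∫ s in (0 : ℝ)..1, |F.D s / 2 + t * (F.D.D.D s / 2)| := by
  rw [← integral_line_abs]
  constructor
  · unfold torusTopEigMoment
    refine integral_congr_ae (ae_of_all _ fun x => ?_)
    obtain ⟨h1, -, h3, -⟩ := lam_sq_line F t x
    dsimp only
    rw [← lam_strainFlat, max_eq_left h3, Real.rpow_one, eq_abs_of_sq_eq h1 h3]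
  · unfold torusNegBotEigMoment
    refine integral_congr_ae (ae_of_all _ fun x => ?_)
    obtain ⟨-, h1, -, h4⟩ := lam_sq_line F t x
    dsimp only
    rw [← lam_neg_strainFlat, max_eq_left h4, Real.rpow_one, eq_abs_of_sq_eq h1 h4]

/-- `∫₀¹ |P/2 + tQ/2| = ½ ∫₀¹ |P + tQ|`. [ours; bookkeeping] -/
theorem integral_abs_half (P Q : ShearProfile) (t : ℝ) :
    ∫ s in (0 : ℝ)..1, |P s / 2 + t * (Q s / 2)| = (1 / 2) * ∫ s in (0 : ℝ)..1, |P s + t * Q s| := by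
  rw [← intervalIntegral.integral_const_mul]
  refine intervalIntegral.integral_congr fun s _ => ?_
  rw [show P s / 2 + t * (Q s / 2) = (P s + t * Q s) / 2 by ring, abs_div, abs_two]
  ring

/-- **At `t = 0`: `∫(λ₁⁺)¹(u_F) = ∫((−λ₃)⁺)¹(u_F) = ½∫₀¹|F′|`.** [ours] -/
theorem topEigMoment_one_lamU :
    torusTopEigMoment 1 (lamU F) = (1 / 2) * ∫ s in (0 : ℝ)..1, |F.D s| ∧
      torusNegBotEigMoment 1 (lamU F) = (1 / 2) * ∫ s in (0 : ℝ)..1, |F.D s| := by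
  have h := topEigMoment_one_line F 0
  rw [zero_smul, add_zero, integral_abs_half] at h
  simpa using h

/-! ## 2. Bookkeeping: a heat line along which `Φ` never drops has non-positive dissipation -/

/-- **If `Φ(v) ≤ Φ(v + tΔv)` for every `t > 0` then `heatDissipation Φ v ≤ 0`.** [ours, bookkeeping] -/
theorem heatDissipation_nonpos_of_line_le {d : Type*} [Fintype d] [DecidableEq d]
    {Φ : (UnitAddTorus d → EuclideanSpace ℝ d) → ℝ} {v : UnitAddTorus d → EuclideanSpace ℝ d}
    (h : ∀ t : ℝ, 0 < t → Φ v ≤ Φ (v + t • Torus.laplacian v)) : heatDissipation Φ v ≤ 0 := by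
  haveI : Nonempty {t : ℝ // 0 < t} := ⟨⟨1, one_pos⟩⟩
  exact ciSup_le fun t => div_nonpos_of_nonpos_of_nonneg (sub_nonpos.2 (h t.1 t.2)) t.2.le

/-! ## 3. The witness profile `F(s) = −cos(2πs)/(2π) + cos³(2πs)/(6π)`, `F′ = sin³(2π·)` -/

/-- **The witness profile** `F(s) = −cos(2πs)/(2π) + cos³(2πs)/(6π)` (zero-mean primitive of `sin³(2πs)`).
Search for candidate a priori estimates; no regularity claim. [ours] -/
def sinCubePrim : ShearProfile where
  toFun := fun s => -Real.cos (2 * Real.pi * s) / (2 * Real.pi) + Real.cos (2 * Real.pi * s) ^ 3 / (6 * Real.pi)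
  periodic' := fun s => by
    show -Real.cos (2 * Real.pi * (s + 1)) / (2 * Real.pi) + Real.cos (2 * Real.pi * (s + 1)) ^ 3 / (6 * Real.pi) =
      -Real.cos (2 * Real.pi * s) / (2 * Real.pi) + Real.cos (2 * Real.pi * s) ^ 3 / (6 * Real.pi)
    rw [mul_add, mul_one, Real.cos_add_two_pi]
  contDiff' := by
    have hc : ContDiff ℝ ∞ fun s : ℝ => Real.cos (2 * Real.pi * s) :=
      Real.contDiff_cos.comp (contDiff_const.mul contDiff_id)
    exact (hc.neg.div_const _).add ((hc.pow 3).div_const _)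

/-- Values of the witness profile. [ours; bookkeeping] -/
theorem sinCubePrim_apply (s : ℝ) :
    sinCubePrim s = -Real.cos (2 * Real.pi * s) / (2 * Real.pi) + Real.cos (2 * Real.pi * s) ^ 3 / (6 * Real.pi) :=
  rfl

/-- `d/ds cos(2πs) = −2π sin(2πs)`. [folklore] -/
theorem hasDerivAt_cos_two_pi_mul (s : ℝ) :
    HasDerivAt (fun s : ℝ => Real.cos (2 * Real.pi * s)) (-Real.sin (2 * Real.pi * s) * (2 * Real.pi)) s :=
  (Real.hasDerivAt_cos (2 * Real.pi * s)).comp s (by simpa using (hasDerivAt_id s).const_mul (2 * Real.pi))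
/-- `d/ds sin(2πs) = 2π cos(2πs)`. [folklore] -/
theorem hasDerivAt_sin_two_pi_mul (s : ℝ) :
    HasDerivAt (fun s : ℝ => Real.sin (2 * Real.pi * s)) (Real.cos (2 * Real.pi * s) * (2 * Real.pi)) s :=
  (Real.hasDerivAt_sin (2 * Real.pi * s)).comp s (by simpa using (hasDerivAt_id s).const_mul (2 * Real.pi))

/-- **`F′(s) = sin³(2πs)`** (as a derivative). [ours] -/
theorem hasDerivAt_sinCubePrim (s : ℝ) :
    HasDerivAt (sinCubePrim : ℝ → ℝ) (Real.sin (2 * Real.pi * s) ^ 3) s := by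
  have hc := hasDerivAt_cos_two_pi_mul s
  have h : HasDerivAt (fun x : ℝ => -Real.cos (2 * Real.pi * x) / (2 * Real.pi) +
      Real.cos (2 * Real.pi * x) ^ 3 / (6 * Real.pi)) _ s :=
    (hc.fun_neg.div_const (2 * Real.pi)).fun_add ((hc.fun_pow 3).div_const (6 * Real.pi))
  refine h.congr_deriv ?_
  have hπ : Real.pi ≠ 0 := Real.pi_ne_zero
  simp only [Nat.cast_ofNat, Nat.reduceSub, Real.cos_sq']
  field_simp
  ring

/-- **`F′ = sin³(2π·)`** (the derivative profile). [ours] -/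
theorem sinCubePrim_D (s : ℝ) : sinCubePrim.D s = Real.sin (2 * Real.pi * s) ^ 3 := by
  rw [ShearProfile.D_apply]; exact (hasDerivAt_sinCubePrim s).deriv

/-- **`F″(s) = 6π sin²(2πs) cos(2πs)`.** [ours] -/
theorem sinCubePrim_DD (s : ℝ) :
    sinCubePrim.D.D s = 6 * Real.pi * Real.sin (2 * Real.pi * s) ^ 2 * Real.cos (2 * Real.pi * s) := by
  rw [ShearProfile.D_apply, show (sinCubePrim.D : ℝ → ℝ) = fun s => Real.sin (2 * Real.pi * s) ^ 3 from
    funext sinCubePrim_D, ((hasDerivAt_sin_two_pi_mul s).fun_pow 3).deriv]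
  simp only [Nat.cast_ofNat, Nat.reduceSub]
  ring

/-- `F″` vanishes wherever `sin(2πs)` does. [ours; bookkeeping] -/
theorem sinCubePrim_DD_eq_zero {s : ℝ} (hs : Real.sin (2 * Real.pi * s) = 0) : sinCubePrim.D.D s = 0 := by
  rw [sinCubePrim_DD, hs]; ring

/-- `sin(2π·0) = 0`, `sin(2π·½) = 0`, `sin(2π·1) = 0`. [folklore] -/
theorem sin_two_pi_mul_zero_half_one :
    Real.sin (2 * Real.pi * 0) = 0 ∧ Real.sin (2 * Real.pi * (1 / 2)) = 0 ∧ Real.sin (2 * Real.pi * 1) = 0 :=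
  ⟨by simp, by rw [show 2 * Real.pi * (1 / 2) = Real.pi by ring, Real.sin_pi], by rw [mul_one, Real.sin_two_pi]⟩

/-- `F(0) = F(1) = −1/(3π)`, `F(½) = 1/(3π)`. [ours; bookkeeping] -/
theorem sinCubePrim_values :
    sinCubePrim 0 = -(1 / (3 * Real.pi)) ∧ sinCubePrim (1 / 2) = 1 / (3 * Real.pi) ∧
      sinCubePrim 1 = -(1 / (3 * Real.pi)) := by
  have hπ : Real.pi ≠ 0 := Real.pi_ne_zero
  refine ⟨?_, ?_, ?_⟩
  · rw [sinCubePrim_apply, mul_zero, Real.cos_zero]; field_simp; norm_num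
  · rw [sinCubePrim_apply, show 2 * Real.pi * (1 / 2) = Real.pi by ring, Real.cos_pi]; field_simp; norm_num
  · rw [sinCubePrim_apply, mul_one, Real.cos_two_pi]; field_simp; norm_num

/-- Every profile is differentiated by its derivative profile. [folklore] -/
theorem hasDerivAt_D (Q : ShearProfile) (x : ℝ) : HasDerivAt (Q : ℝ → ℝ) (Q.D x) x :=
  ((Q.contDiff.differentiable (by simp)) x).hasDerivAt

/-- **FTC on a half period**: `∫ₐᵇ (F′ + tF‴) = (F(b) + tF″(b)) − (F(a) + tF″(a))`. [ours; bookkeeping] -/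
theorem integral_line_eq_sub (t a b : ℝ) :
    ∫ s in a..b, (F.D s + t * F.D.D.D s) = (F b + t * F.D.D b) - (F a + t * F.D.D a) := by
  have hderiv : ∀ s ∈ uIcc a b, HasDerivAt (fun s => F s + t * F.D.D s) (F.D s + t * F.D.D.D s) s :=
    fun s _ => (hasDerivAt_D F s).add ((hasDerivAt_D F.D.D s).const_mul t)
  exact intervalIntegral.integral_eq_sub_of_hasDerivAt hderiv
    ((F.D.continuous.add (continuous_const.mul F.D.D.D.continuous)).intervalIntegrable _ _)

/-- **The two half-period integrals of `F′ + tF‴` for the witness**: `∫₀^½ = 2/(3π)`, `∫_½^1 = −2/(3π)`,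
for EVERY `t` (the `t`-terms drop because `F″(0) = F″(½) = F″(1) = 0`). [ours] -/
theorem integral_line_halves (t : ℝ) :
    ∫ s in (0 : ℝ)..(1 / 2), (sinCubePrim.D s + t * sinCubePrim.D.D.D s) = 2 / (3 * Real.pi) ∧
      ∫ s in (1 / 2 : ℝ)..1, (sinCubePrim.D s + t * sinCubePrim.D.D.D s) = -(2 / (3 * Real.pi)) := by
  obtain ⟨h0, hh, h1⟩ := sin_two_pi_mul_zero_half_one
  obtain ⟨v0, vh, v1⟩ := sinCubePrim_values
  rw [integral_line_eq_sub, integral_line_eq_sub, sinCubePrim_DD_eq_zero h0, sinCubePrim_DD_eq_zero hh,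
    sinCubePrim_DD_eq_zero h1, v0, vh, v1]
  constructor <;> ring

/-- **Lower bound along the whole heat line: `∫₀¹ |F′ + tF‴| ≥ 4/(3π)` for every real `t`.** [ours] -/
theorem integral_abs_line_ge (t : ℝ) :
    4 / (3 * Real.pi) ≤ ∫ s in (0 : ℝ)..1, |sinCubePrim.D s + t * sinCubePrim.D.D.D s| := by
  set g : ℝ → ℝ := fun s => sinCubePrim.D s + t * sinCubePrim.D.D.D s with hg
  have hgc : Continuous g := sinCubePrim.D.continuous.add (continuous_const.mul sinCubePrim.D.D.D.continuous)
  have hi : ∀ a b : ℝ, IntervalIntegrable (fun s => |g s|) volume a b := fun a b => hgc.abs.intervalIntegrable _ _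
  obtain ⟨hA, hB⟩ := integral_line_halves t
  have h1 : 2 / (3 * Real.pi) ≤ ∫ s in (0 : ℝ)..(1 / 2), |g s| := by
    have := intervalIntegral.abs_integral_le_integral_abs (f := g) (μ := volume)
      (show (0 : ℝ) ≤ 1 / 2 by norm_num)
    rwa [show (∫ s in (0 : ℝ)..(1 / 2), g s) = 2 / (3 * Real.pi) from hA, abs_of_pos (by positivity)] at this
  have h2 : 2 / (3 * Real.pi) ≤ ∫ s in (1 / 2 : ℝ)..1, |g s| := by
    have := intervalIntegral.abs_integral_le_integral_abs (f := g) (μ := volume)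
      (show (1 / 2 : ℝ) ≤ 1 by norm_num)
    rwa [show (∫ s in (1 / 2 : ℝ)..1, g s) = -(2 / (3 * Real.pi)) from hB, abs_neg,
      abs_of_pos (by positivity)] at this
  have hsplit := intervalIntegral.integral_add_adjacent_intervals (hi 0 (1 / 2)) (hi (1 / 2) 1)
  change 4 / (3 * Real.pi) ≤ ∫ s in (0 : ℝ)..1, |g s|
  rw [← hsplit, show (4 : ℝ) / (3 * Real.pi) = 2 / (3 * Real.pi) + 2 / (3 * Real.pi) by ring]
  exact add_le_add h1 h2

/-- `sin(2πs) ≥ 0` on `[0, ½]` and `sin(2πs) ≤ 0` on `[½, 1]`. [folklore] -/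
theorem sin_two_pi_mul_sign (s : ℝ) :
    (s ∈ Icc (0 : ℝ) (1 / 2) → 0 ≤ Real.sin (2 * Real.pi * s)) ∧
      (s ∈ Icc (1 / 2 : ℝ) 1 → Real.sin (2 * Real.pi * s) ≤ 0) := by
  have hπ := Real.pi_pos
  refine ⟨fun hs => ?_, fun hs => ?_⟩
  · exact Real.sin_nonneg_of_nonneg_of_le_pi (by nlinarith [hs.1]) (by nlinarith [hs.2])
  · rw [← Real.sin_sub_two_pi]
    exact Real.sin_nonpos_of_nonpos_of_neg_pi_le (by nlinarith [hs.2]) (by nlinarith [hs.1])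

/-- **`∫₀¹ |F′| = 4/(3π)`** for the witness (`F′ = sin³ ≥ 0` on `[0,½]`, `≤ 0` on `[½,1]`). [ours] -/
theorem integral_abs_D :
    ∫ s in (0 : ℝ)..1, |sinCubePrim.D s| = 4 / (3 * Real.pi) := by
  have hi : ∀ a b : ℝ, IntervalIntegrable (fun s => |sinCubePrim.D s|) volume a b := fun a b =>
    sinCubePrim.D.continuous.abs.intervalIntegrable _ _
  obtain ⟨hA, hB⟩ := integral_line_halves 0
  simp only [zero_mul, add_zero] at hA hB
  have h1 : ∫ s in (0 : ℝ)..(1 / 2), |sinCubePrim.D s| = 2 / (3 * Real.pi) := by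
    rw [← hA]
    refine intervalIntegral.integral_congr fun s hs => ?_
    rw [uIcc_of_le (by norm_num : (0 : ℝ) ≤ 1 / 2)] at hs
    have h := (sin_two_pi_mul_sign s).1 hs
    rw [sinCubePrim_D, abs_of_nonneg (pow_nonneg h 3)]
  have h2 : ∫ s in (1 / 2 : ℝ)..1, |sinCubePrim.D s| = 2 / (3 * Real.pi) := by
    rw [show (2 : ℝ) / (3 * Real.pi) = -∫ s in (1 / 2 : ℝ)..1, sinCubePrim.D s by rw [hB]; ring,
      ← intervalIntegral.integral_neg]
    refine intervalIntegral.integral_congr fun s hs => ?_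
    rw [uIcc_of_le (by norm_num : (1 / 2 : ℝ) ≤ 1)] at hs
    have h := (sin_two_pi_mul_sign s).2 hs
    rw [sinCubePrim_D, abs_of_nonpos (by nlinarith [sq_nonneg (Real.sin (2 * Real.pi * s)), h])]
  rw [← intervalIntegral.integral_add_adjacent_intervals (hi 0 (1 / 2)) (hi (1 / 2) 1), h1, h2]
  ring

/-! ## 4. The laminate `u_F`, `F = sinCubePrim`: zero mean, `Φ₁ = 2/(3π)`, dissipation `0` -/

/-- Lemma D for one profile: `∫_{T³} P(x₂) dx = ∫₀¹ P`. [ours; bookkeeping] -/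
theorem integral_dirFun_e2 (P : ShearProfile) : ∫ x, dirFun e2 P x = ∫ s in (0 : ℝ)..1, P s := by
  have h := integral_comp_dirForm e2_ne_zero (F := P.onCircle) P.continuous_onCircle.aestronglyMeasurable
  simp only [dirFun] at h ⊢
  rw [h, CellularStretching.integral_circle_eq_intervalIntegral]
  simp only [ShearProfile.onCircle_coe]

/-- **A laminate with a zero-mean profile is a zero-mean field.** [ours] -/
theorem hasZeroMean_lamU (P : ShearProfile) (hP : ∫ s in (0 : ℝ)..1, P s = 0) :
    Torus.HasZeroMean (lamU P) := by
  unfold Torus.HasZeroMean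
  show ∫ x, dirFun e2 P x • EuclideanSpace.single (0 : Fin 3) (1 : ℝ) = 0
  rw [_root_.integral_smul_const, integral_dirFun_e2, hP, zero_smul]

/-- **`∫₀¹ F = 0`** (primitive `G = −sin(2π·)/(4π²) + (sin(2π·) − sin³(2π·)/3)/(12π²)`, `G(1) = G(0)`). [ours] -/
theorem integral_sinCubePrim : ∫ s in (0 : ℝ)..1, sinCubePrim s = 0 := by
  have hπ : Real.pi ≠ 0 := Real.pi_ne_zero
  have hderiv : ∀ s ∈ uIcc (0 : ℝ) 1, HasDerivAt (fun s : ℝ => -Real.sin (2 * Real.pi * s) / (4 * Real.pi ^ 2) +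
      (Real.sin (2 * Real.pi * s) - Real.sin (2 * Real.pi * s) ^ 3 / 3) / (12 * Real.pi ^ 2)) (sinCubePrim s) s := by
    intro s _
    have hs := hasDerivAt_sin_two_pi_mul s
    have h : HasDerivAt (fun s : ℝ => -Real.sin (2 * Real.pi * s) / (4 * Real.pi ^ 2) +
        (Real.sin (2 * Real.pi * s) - Real.sin (2 * Real.pi * s) ^ 3 / 3) / (12 * Real.pi ^ 2)) _ s :=
      (hs.fun_neg.div_const (4 * Real.pi ^ 2)).fun_add
        ((hs.fun_sub ((hs.fun_pow 3).div_const 3)).div_const (12 * Real.pi ^ 2))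
    refine h.congr_deriv ?_
    simp only [sinCubePrim_apply, Nat.cast_ofNat, Nat.reduceSub, Real.sin_sq]
    field_simp
    ring
  rw [intervalIntegral.integral_eq_sub_of_hasDerivAt hderiv (sinCubePrim.continuous.intervalIntegrable _ _)]
  simp only [mul_one, mul_zero, Real.sin_zero, Real.sin_two_pi]
  norm_num

/-- **The witness laminate is zero-mean** (smooth and divergence free by `isSmooth_lamU`, `isDivFree_lamU`). [ours] -/
theorem hasZeroMean_lamU_sinCubePrim : Torus.HasZeroMean (lamU sinCubePrim) :=
  hasZeroMean_lamU _ integral_sinCubePrim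

/-- **`∫(λ₁⁺)(u_F) = ∫((−λ₃)⁺)(u_F) = 2/(3π)`** for the witness. [ours] -/
theorem topEigMoment_one_sinCubePrim :
    torusTopEigMoment 1 (lamU sinCubePrim) = 2 / (3 * Real.pi) ∧
      torusNegBotEigMoment 1 (lamU sinCubePrim) = 2 / (3 * Real.pi) := by
  have h := topEigMoment_one_lamU sinCubePrim
  rwa [integral_abs_D, show (1 / 2 : ℝ) * (4 / (3 * Real.pi)) = 2 / (3 * Real.pi) by ring] at h

/-- **Along the whole heat line the two `q = 1` moments never drop below their initial value**:
`∫(λ₁⁺)(u_F) ≤ ∫(λ₁⁺)(u_F + tΔu_F)` and the same for `(−λ₃)⁺`, every real `t`. [ours] -/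
theorem topEigMoment_one_le_line (t : ℝ) :
    torusTopEigMoment 1 (lamU sinCubePrim) ≤
        torusTopEigMoment 1 (lamU sinCubePrim + t • Torus.laplacian (lamU sinCubePrim)) ∧
      torusNegBotEigMoment 1 (lamU sinCubePrim) ≤
        torusNegBotEigMoment 1 (lamU sinCubePrim + t • Torus.laplacian (lamU sinCubePrim)) := by
  obtain ⟨h0, h0'⟩ := topEigMoment_one_sinCubePrim
  obtain ⟨ht, ht'⟩ := topEigMoment_one_line sinCubePrim t
  rw [integral_abs_half] at ht ht'
  have hge := integral_abs_line_ge t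
  have e : (2 : ℝ) / (3 * Real.pi) = (1 / 2) * (4 / (3 * Real.pi)) := by ring
  constructor
  · rw [h0, ht, e]; exact mul_le_mul_of_nonneg_left hge (by norm_num)
  · rw [h0', ht', e]; exact mul_le_mul_of_nonneg_left hge (by norm_num)

/-- **`heatDissipation (∫(λ₁⁺)) u_F ≤ 0` and `heatDissipation (∫((−λ₃)⁺)) u_F ≤ 0`** for the witness. [ours] -/
theorem heatDissipation_topEigMoment_one_nonpos :
    heatDissipation (torusTopEigMoment 1) (lamU sinCubePrim) ≤ 0 ∧
      heatDissipation (torusNegBotEigMoment 1) (lamU sinCubePrim) ≤ 0 :=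
  ⟨heatDissipation_nonpos_of_line_le fun t _ => (topEigMoment_one_le_line t).1,
    heatDissipation_nonpos_of_line_le fun t _ => (topEigMoment_one_le_line t).2⟩

/-! ## 5. Booking: `C_λ(1) = 0`; the `q = 1` endpoint of the node is FALSE (both cores, and `Φ₁ + Ψ₁`) -/

/-- **`C_λ(1) = 0`**: the kernel window `[0, 4π²]` (`TopEig.topEigHeatRate_mem_Icc`, `q = 1`) collapses. [ours] -/
theorem topEigHeatRate_one : topEigHeatRate 1 = 0 := by
  obtain ⟨hΦ, -⟩ := topEigMoment_one_sinCubePrim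
  have hpos : 0 < torusTopEigMoment 1 (lamU sinCubePrim) := by rw [hΦ]; positivity
  have h := topEigHeatRate_le_ratio le_rfl (lamU sinCubePrim) (isSmooth_lamU _) (isDivFree_lamU _)
    hasZeroMean_lamU_sinCubePrim hpos
  have h0 : topEigHeatRate 1 ≤ 0 :=
    h.trans (div_nonpos_of_nonpos_of_nonneg heatDissipation_topEigMoment_one_nonpos.1 hpos.le)
  exact le_antisymm h0 (topEigHeatRate_nonneg le_rfl)

/-- **`¬ TopEigHeatCoercivePos 1`** — Lemma L-λ(1), `λ₁` core, is FALSE. [ours] -/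
theorem not_topEigHeatCoercivePos_one : ¬ TopEigHeatCoercivePos (d := Fin 3) 1 :=
  (not_topEigHeatCoercivePos_iff_rate_eq_zero le_rfl).2 topEigHeatRate_one

/-- `TopEigHeatCoercive 1 c ↔ c ≤ 0`. [ours] -/
theorem topEigHeatCoercive_one_iff {c : ℝ} : TopEigHeatCoercive (d := Fin 3) 1 c ↔ c ≤ 0 := by
  rw [topEigHeatCoercive_iff_le_rate le_rfl, topEigHeatRate_one]

/-- `negBotEigHeatRate 1 = 0`. [ours] -/
theorem negBotEigHeatRate_one : negBotEigHeatRate 1 = 0 := by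
  rw [negBotEigHeatRate_eq, topEigHeatRate_one]

/-- **`¬ NegBotEigHeatCoercivePos 1`** — Lemma L-λ(1), `−λ₃` core, is FALSE. [ours] -/
theorem not_negBotEigHeatCoercivePos_one : ¬ NegBotEigHeatCoercivePos (d := Fin 3) 1 := by
  rw [negBotEigHeatCoercivePos_iff_rate_pos le_rfl, topEigHeatRate_one]; exact lt_irrefl 0

/-- **The dissipation of the witness is exactly `0`** for both cores (`≤ 0` above; `≥ 0` because rate `0`
is admissible, `topEigHeatCoercive_iff_le_rate`). [ours] -/
theorem heatDissipation_topEigMoment_one_sinCubePrim :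
    heatDissipation (torusTopEigMoment 1) (lamU sinCubePrim) = 0 ∧
      heatDissipation (torusNegBotEigMoment 1) (lamU sinCubePrim) = 0 := by
  obtain ⟨h1, h2⟩ := heatDissipation_topEigMoment_one_nonpos
  have g1 : TopEigHeatCoercive (d := Fin 3) 1 0 := (topEigHeatCoercive_iff_le_rate le_rfl).2 (topEigHeatRate_nonneg le_rfl)
  have g2 : NegBotEigHeatCoercive (d := Fin 3) 1 0 := (negBotEigHeatCoercive_iff_le_rate le_rfl).2 (topEigHeatRate_nonneg le_rfl)
  have k1 := g1 (by simp) (lamU sinCubePrim) (isSmooth_lamU _) (isDivFree_lamU _) hasZeroMean_lamU_sinCubePrim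
  have k2 := g2 (by simp) (lamU sinCubePrim) (isSmooth_lamU _) (isDivFree_lamU _) hasZeroMean_lamU_sinCubePrim
  rw [zero_mul] at k1 k2
  exact ⟨le_antisymm h1 k1, le_antisymm h2 k2⟩

/-- **Door D-K6 (c) at the endpoint: `¬ TopBotEigHeatCoercivePos 1`** — the symmetrised core `Φ₁ + Ψ₁`
(`SpectralMixtureCandidates.topBotEigMoment 1`) is not heat-coercive at any positive rate either (same
laminate: `Φ₁ + Ψ₁` is constant-or-larger along its heat line). [ours] -/
theorem not_topBotEigHeatCoercivePos_one : ¬ TopBotEigHeatCoercivePos (d := Fin 3) 1 := by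
  rintro ⟨c, hc, h⟩
  obtain ⟨hΦ, hΨ⟩ := topEigMoment_one_sinCubePrim
  have hD : heatDissipation (topBotEigMoment (d := Fin 3) 1) (lamU sinCubePrim) ≤ 0 :=
    heatDissipation_nonpos_of_line_le fun t _ => by
      obtain ⟨a, b⟩ := topEigMoment_one_le_line t
      exact add_le_add a b
  have hv := h (by simp) (lamU sinCubePrim) (isSmooth_lamU _) (isDivFree_lamU _) hasZeroMean_lamU_sinCubePrim
  have hpos : 0 < topBotEigMoment (d := Fin 3) 1 (lamU sinCubePrim) := by
    unfold topBotEigMoment; rw [hΦ, hΨ]; positivity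
  have : 0 < c * topBotEigMoment (d := Fin 3) 1 (lamU sinCubePrim) := mul_pos hc hpos
  linarith

end TopEigLaminate

end Summit.NavierStokesRegularity.FunctionalMining

end
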